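import Mathlib
import Literature.Computability.AlgebraicComplexity.MignonRessayreBound
import Literature.Computability.AlgebraicComplexity.LRPencilOfMatrix
import Summits.ValiantsHypothesis.ValiantsHypothesis.Theorems.GrenetZeonTwoDimCoefficientsDefs
import Summits.ValiantsHypothesis.ValiantsHypothesis.Theorems.GrenetZeonTwoDimCoefficientsUnitCase
import Summits.ValiantsHypothesis.ValiantsHypothesis.Theorems.RefutationDegreeBeyondHessianNsKernelPlane

/-!
# Crux `GrenetZeon.TwoDimCoefficients` (stmt-ValiantsHypothesis-8062), line `dim2_cases`:
# the registered stub `stub_unitDichotomy` — the UNIT CASE closes by kernel planes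

**Theorem (`sq_le_two_mul_of_det_eq_C_add_perPoly_mul`).** Let `A` be an affine `m × m` matrix over
`ℂ[x_ij]` (`n ≥ 3`) with `det A = c + per_n · q`, `c ≠ 0`, `q ≠ 0` — equivalently (8062-p1's
`exists_eq_C_add_perPoly_mul`) `det A` has no zero on the permanental hypersurface and is not
constant.  Then `n² ≤ 2m`.  Hence `UnitDichotomy` (`stub_unitDichotomy`), with the registered bound
`n² ≤ 2m + 2`.

The point of the proof is that it never looks at the Hessian of `det A` (which is useless when
`det A` is a powerful polynomial such as `c·(1 + per_n S)²`, the obstruction recorded in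
`Cruxes/TwoDimCoefficients/UNIT-CASE-NOTE.md`), only at the zero SET of `det A`, through the
kernel-plane form of the Mignon–Ressayre argument:

1. a good singular point: for `x₀` with `per(x₀) q(x₀) det(Hess per)(x₀) ≠ 0` the one-variable
   polynomial `λ ↦ det A(λ x₀) = c + λⁿ per(x₀) q(λ x₀)` is non-constant, so it has a root `λ₀ ≠ 0`;
   at `P = λ₀ x₀` the matrix `A(P)` is singular and `Hess per(P) = λ₀^{n-2} Hess per(x₀)` is
   non-degenerate (homogeneity);
2. kernel plane: for `w ≠ 0` in `ker A(P)`, the directions `v` with `(A(P+v) − A(P)) w = 0` form a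
   linear space `V` of dimension `≥ n² − m` (rank–nullity), and `det A` vanishes on `P + V`;
3. so `per · q = −c` on `P + V`: the permanent has NO zero on the affine space `P + V`, hence is
   CONSTANT there (a zero-free polynomial on an affine space over `ℂ` is constant: restrict to lines);
4. differentiating twice along `V` (directional derivatives of a polynomial vanishing on a linear
   space vanish on it), `V` is totally isotropic for the non-degenerate symmetric form `Hess per(P)`,
   so `dim V ≤ n²/2` (`LinearMap.BilinForm.finrank_orthogonal`); with step 2, `n² − m ≤ n²/2`.

For `det A = per_n` itself this is the classical linear-subspace proof of Mignon–Ressayre's bound;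
the only addition is step 3.  In particular `dc(c·u^k) ≥ n²/2` for every non-constant
`u ≡ const (mod per_n)`, e.g. `dc((per_n + K)²) ≥ n²/2`.

HONEST FRAMING: closes a registered stub of an ASIDE item; a constant-factor statement in the
Mignon–Ressayre regime; `VP ≠ VNP` is not moved.

References: T. Mignon, N. Ressayre, Int. Math. Res. Not. 2004:79, Thm. 1.1; J. M. Landsberg,
*Geometry and Complexity Theory* (2017), §6.4 (linear spaces on `{det_n = 0}` and the Hessian).
-/

set_option linter.dupNamespace false

noncomputable section

namespace Summit.ValiantsHypothesis.ValiantsHypothesis.Cruxes.TwoDimCoefficients.DimTwoCases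

open MvPolynomial Matrix
open Literature.Computability.AlgebraicComplexity
open Summit.ValiantsHypothesis.ValiantsHypothesis.Theorems.RefutationDegreeBeyondHessianNs
  (eval_aeval_line map_eval_mulVec_eq)

/-! ### Lines: restriction of a polynomial to `t ↦ t • y + z` -/

section Lines

variable {K : Type*} [Field K] {σ : Type*}

/-- **Chain rule along a line.** The derivative of `t ↦ f(t • y + z)` is the restriction to the line
of the directional derivative `Σ_e y_e ∂_e f`. [folklore] -/
theorem derivative_aeval_line [Fintype σ] [DecidableEq σ] (f : MvPolynomial σ K) (y z : σ → K) :
    Polynomial.derivative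
        (aeval (fun e => Polynomial.C (y e) * Polynomial.X + Polynomial.C (z e)) f) =
      aeval (fun e => Polynomial.C (y e) * Polynomial.X + Polynomial.C (z e))
        (∑ e, C (y e) * pderiv e f) := by
  induction f using MvPolynomial.induction_on with
  | C a => simp
  | add p q hp hq =>
      simp only [map_add, (pderiv _).map_add, mul_add, Finset.sum_add_distrib, hp, hq]
  | mul_X p e hp =>
      have hsum : ∑ e', C (y e') * pderiv e' (p * X e) =
          (∑ e', C (y e') * pderiv e' p) * X e + C (y e) * p := by
        simp only [pderiv_mul, pderiv_X, mul_add, Finset.sum_add_distrib, Finset.sum_mul]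
        congr 1
        · exact Finset.sum_congr rfl fun e' _ => by ring
        · rw [Finset.sum_eq_single e]
          · simp
          · intro e' _ hne
            rw [Pi.single_eq_of_ne (Ne.symm hne), mul_zero, mul_zero]
          · simp
      rw [hsum]
      simp only [map_add, map_mul, aeval_X, aeval_C, Polynomial.derivative_mul,
        Polynomial.derivative_X, Polynomial.derivative_C, add_zero, mul_one,
        hp, Polynomial.algebraMap_eq]
      ring

/-- **Directional derivatives of a polynomial vanishing on a linear space vanish on it.** If `f`
vanishes on the submodule `V` and `y ∈ V`, then `Σ_e y_e ∂_e f` vanishes on `V`. [folklore] -/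
theorem eval_dirDeriv_eq_zero_of_forall_mem [Fintype σ] [DecidableEq σ] [Infinite K]
    (f : MvPolynomial σ K) (V : Submodule K (σ → K)) (hf : ∀ z ∈ V, eval z f = 0)
    {y : σ → K} (hy : y ∈ V) {z : σ → K} (hz : z ∈ V) :
    eval z (∑ e, C (y e) * pderiv e f) = 0 := by
  set G := aeval (fun e => Polynomial.C (y e) * Polynomial.X + Polynomial.C (z e)) f with hG
  have hG0 : G = 0 := by
    apply Polynomial.funext
    intro t
    rw [hG, eval_aeval_line, Polynomial.eval_zero]
    exact hf _ (V.add_mem (V.smul_mem t hy) hz)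
  have h := derivative_aeval_line f y z
  rw [← hG, hG0, Polynomial.derivative_zero] at h
  have h0 := congrArg (Polynomial.eval (0 : K)) h
  rw [Polynomial.eval_zero, eval_aeval_line, zero_smul, zero_add] at h0
  exact h0.symm

/-- **A zero-free polynomial on a linear space is constant there** (`ℂ` algebraically closed: on
each line through the origin the restriction is a one-variable polynomial without roots).
[folklore] -/
theorem eval_eq_eval_zero_of_forall_mem_ne_zero (g : MvPolynomial σ ℂ) (V : Submodule ℂ (σ → ℂ))
    (hg : ∀ v ∈ V, eval v g ≠ 0) {v : σ → ℂ} (hv : v ∈ V) : eval v g = eval 0 g := by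
  set Pl : Polynomial ℂ :=
    aeval (fun e => Polynomial.C (v e) * Polynomial.X + Polynomial.C ((0 : σ → ℂ) e)) g with hPl
  have hroot : ∀ t : ℂ, Polynomial.eval t Pl ≠ 0 := by
    intro t
    rw [hPl, eval_aeval_line, add_zero]
    exact hg _ (V.smul_mem t hv)
  have hdeg : Pl.degree ≤ 0 := by
    by_contra h
    obtain ⟨t, ht⟩ := Complex.exists_root (not_le.mp h)
    exact hroot t ht
  have hC := Polynomial.eq_C_of_degree_le_zero hdeg
  have h1 : Polynomial.eval 1 Pl = Polynomial.eval 0 Pl := by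
    rw [hC, Polynomial.eval_C, Polynomial.eval_C]
  rw [hPl, eval_aeval_line, eval_aeval_line, one_smul, zero_smul, add_zero, add_zero] at h1
  exact h1

end Lines

/-! ### Isotropy: a polynomial constant on a linear space has it isotropic for its Hessian -/

section Isotropy

variable {σ : Type*} [Fintype σ] [DecidableEq σ]

/-- If `g` is constant on the submodule `V`, then `V` is totally isotropic for the Hessian of `g`
at the origin: `uᵀ H(g)(0) v = 0` for `u, v ∈ V`. [folklore] -/
theorem hess0_isOrtho_of_forall_mem (g : MvPolynomial σ ℂ) (V : Submodule ℂ (σ → ℂ))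
    (hg : ∀ v ∈ V, eval v g = eval 0 g) {u v : σ → ℂ} (hu : u ∈ V) (hv : v ∈ V) :
    Matrix.toBilin' (hess0 g) u v = 0 := by
  -- `g - g(0)` vanishes on `V`; differentiate along `v`, then along `u`, and evaluate at `0 ∈ V`
  set f : MvPolynomial σ ℂ := g - C (eval 0 g) with hf
  have hf0 : ∀ z ∈ V, eval z f = 0 := fun z hz => by
    rw [hf, map_sub, eval_C, hg z hz, sub_self]
  have h1 : ∀ z ∈ V, eval z (∑ e, C (v e) * pderiv e f) = 0 := fun z hz =>
    eval_dirDeriv_eq_zero_of_forall_mem f V hf0 hv hz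
  have h2 := eval_dirDeriv_eq_zero_of_forall_mem _ V h1 hu V.zero_mem
  rw [Matrix.toBilin'_apply, ← h2, MvPolynomial.eval_zero]
  simp only [map_sum, map_mul, pderiv_C_mul, constantCoeff_C, hess0_apply, hf,
    (pderiv _).map_sub, pderiv_C, sub_zero, Finset.mul_sum]
  refine Finset.sum_congr rfl fun s _ => Finset.sum_congr rfl fun t _ => ?_
  ring

/-- **Totally isotropic subspaces of a non-degenerate form are at most half-dimensional.** If
`uᵀ H v = 0` for all `u, v` in a submodule `V` of `ℂ^σ` and `det H ≠ 0`, then `2·dim V ≤ #σ`.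
[folklore] -/
theorem two_mul_finrank_le_of_isOrtho (H : Matrix σ σ ℂ) (hH : H.det ≠ 0)
    (V : Submodule ℂ (σ → ℂ)) (hV : ∀ u ∈ V, ∀ v ∈ V, Matrix.toBilin' H u v = 0) :
    2 * Module.finrank ℂ V ≤ Fintype.card σ := by
  have hB : (Matrix.toBilin' H).Nondegenerate :=
    LinearMap.BilinForm.nondegenerate_toBilin'_of_det_ne_zero' H hH
  have hle : V ≤ (Matrix.toBilin' H).orthogonal V := fun v hv =>
    (LinearMap.BilinForm.mem_orthogonal_iff).mpr fun u hu => hV u hu v hv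
  have h1 := Submodule.finrank_mono hle
  rw [LinearMap.BilinForm.finrank_orthogonal hB V, Module.finrank_fintype_fun_eq_card] at h1
  have h2 : Module.finrank ℂ V ≤ Fintype.card σ := by
    calc Module.finrank ℂ V ≤ Module.finrank ℂ (σ → ℂ) := Submodule.finrank_le V
      _ = Fintype.card σ := Module.finrank_fintype_fun_eq_card ℂ
  omega

end Isotropy

/-! ### The unit case -/

section UnitCase

/-- Translation and evaluation: `(transl P f)(v) = f(v + P)`. [folklore] -/
theorem eval_transl {σ : Type*} (P v : σ → ℂ) (f : MvPolynomial σ ℂ) :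
    eval v (transl P f) = eval (v + P) f := by
  rw [transl, ← aeval_eq_eval, ← AlgHom.comp_apply, comp_aeval]
  have h : (fun s => (aeval v) (X s + C (P s) : MvPolynomial σ ℂ)) = v + P := by
    funext s
    simp
  rw [h, aeval_eq_eval]

/-- **The unit case of the dichotomy, sharp form.** If an affine `m × m` determinant equals
`c + per_n · q` with `c ≠ 0` and `q ≠ 0` (`n ≥ 3`), then `n² ≤ 2m`.  (Kernel plane of `A` at a
singular point with non-degenerate `Hess per`; `per` is zero-free hence constant on it; isotropy.)
[cite: MignonRessayre2004, Thm. 1.1] -/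
theorem sq_le_two_mul_of_det_eq_C_add_perPoly_mul {k m : ℕ} (A : AffMat (k + 3) m)
    (hA : IsAffine A) {c : ℂ} (hc : c ≠ 0) {q : MvPolynomial (Fin (k + 3) × Fin (k + 3)) ℂ}
    (hq : q ≠ 0) (hdet : A.det = C c + perPoly (Fin (k + 3)) ℂ * q) :
    (k + 3) ^ 2 ≤ 2 * m := by
  classical
  -- the Hessian matrix of `per` as a matrix of polynomials, and its determinant
  set HP : Matrix (Fin (k + 3) × Fin (k + 3)) (Fin (k + 3) × Fin (k + 3))
      (MvPolynomial (Fin (k + 3) × Fin (k + 3)) ℂ) :=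
    Matrix.of fun s t => pderiv s (pderiv t (perPoly (Fin (k + 3)) ℂ)) with hHP
  have hHPeval : ∀ y, eval y HP.det = (hess0 (transl y (perPoly (Fin (k + 3)) ℂ))).det :=
      fun y => by
    rw [RingHom.map_det, hHP, eval_mapMatrix_pderiv_pderiv_perPoly]
  -- Step 1a: a point `x₀` with `per(x₀) q(x₀) det(Hess per)(x₀) ≠ 0`
  obtain ⟨x₀, hx₀⟩ : ∃ x₀ : Fin (k + 3) × Fin (k + 3) → ℂ, eval x₀ (perPoly (Fin (k + 3)) ℂ * q * HP.det) ≠ 0 := by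
    by_contra hall
    push Not at hall
    obtain ⟨y, -, hy⟩ := exists_eval_perPoly_ne_zero_and_isUnit_hess0 k
    have hHP0 : HP.det ≠ 0 := fun h0 => by
      have := hHPeval y
      rw [h0, map_zero] at this
      exact hy.ne_zero this.symm
    have hF : perPoly (Fin (k + 3)) ℂ * q * HP.det ≠ 0 :=
      mul_ne_zero (mul_ne_zero (perPoly_irreducible (n := Fin (k + 3)) (R := ℂ)).ne_zero hq) hHP0
    exact hF (MvPolynomial.funext fun y => by rw [hall y, map_zero])
  have hper0 : eval x₀ (perPoly (Fin (k + 3)) ℂ) ≠ 0 := fun h => hx₀ (by rw [map_mul, map_mul, h, zero_mul, zero_mul])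
  have hq0 : eval x₀ q ≠ 0 := fun h => hx₀ (by rw [map_mul, map_mul, h, mul_zero, zero_mul])
  have hH0 : eval x₀ HP.det ≠ 0 := fun h => hx₀ (by rw [map_mul, h, mul_zero])
  -- Step 1b: a root `λ₀` of `λ ↦ det A(λ • x₀)`
  set φ : Polynomial ℂ := aeval (fun i => Polynomial.C (x₀ i) * Polynomial.X) A.det with hφ
  have hφeval : ∀ t : ℂ, Polynomial.eval t φ = eval (t • x₀) A.det := fun t => by
    rw [hφ, eval_aeval_C_mul_X]
  have hdet0 : eval (0 : Fin (k + 3) × Fin (k + 3) → ℂ) A.det = c := by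
    rw [hdet, map_add, map_mul, eval_C, eval_zero_perPoly (by omega), zero_mul, add_zero]
  have hφnc : 0 < φ.degree := by
    by_contra h
    have hC := Polynomial.eq_C_of_degree_le_zero (not_lt.mp h)
    have h10 : Polynomial.eval 1 φ = Polynomial.eval 0 φ := by
      rw [hC, Polynomial.eval_C, Polynomial.eval_C]
    rw [hφeval, hφeval, one_smul, zero_smul, hdet0, hdet, map_add, map_mul, eval_C] at h10
    apply mul_ne_zero hper0 hq0
    have : c + eval x₀ (perPoly (Fin (k + 3)) ℂ) * eval x₀ q = c + 0 := by rw [h10, add_zero]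
    exact add_left_cancel this
  obtain ⟨lam, hlam⟩ := Complex.exists_root hφnc
  rw [Polynomial.IsRoot.def, hφeval] at hlam
  have hlam0 : lam ≠ 0 := by
    rintro rfl
    rw [zero_smul, hdet0] at hlam
    exact hc hlam
  set P : Fin (k + 3) × Fin (k + 3) → ℂ := lam • x₀ with hP
  -- the Hessian of `per` at `P` is non-degenerate
  set H : Matrix (Fin (k + 3) × Fin (k + 3)) (Fin (k + 3) × Fin (k + 3)) ℂ :=
    hess0 (transl P (perPoly (Fin (k + 3)) ℂ)) with hH
  have hHdet : H.det ≠ 0 := by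
    rw [hH, hP, hess0_transl_smul_perPoly, Matrix.det_smul, ← hHPeval]
    exact mul_ne_zero (pow_ne_zero _ (pow_ne_zero _ hlam0)) hH0
  -- Step 2: a kernel vector of `A(P)` and the kernel plane `V`
  have hsing : (A.map (eval P)).det = 0 := by
    rw [← RingHom.mapMatrix_apply, ← RingHom.map_det, hlam]
  obtain ⟨w, hw0, hw⟩ := Matrix.exists_mulVec_eq_zero_iff.mpr hsing
  set Φ : (Fin (k + 3) × Fin (k + 3) → ℂ) →ₗ[ℂ] (Fin m → ℂ) :=
    Matrix.mulVecLin (Matrix.of fun i e => (LRPencil.coeffMat A e *ᵥ w) i) with hΦ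
  set V : Submodule ℂ (Fin (k + 3) × Fin (k + 3) → ℂ) := LinearMap.ker Φ with hV
  have hdimV : (k + 3) ^ 2 ≤ Module.finrank ℂ V + m := by
    have h1 := LinearMap.finrank_range_add_finrank_ker Φ
    have h2 : Module.finrank ℂ (LinearMap.range Φ) ≤ m := by
      calc Module.finrank ℂ (LinearMap.range Φ) ≤ Module.finrank ℂ (Fin m → ℂ) :=
            Submodule.finrank_le _
        _ = m := by simp
    have h4 : Module.finrank ℂ (Fin (k + 3) × Fin (k + 3) → ℂ) = (k + 3) ^ 2 := by
      simp [sq]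
    rw [← hV] at h1
    omega
  -- `det A` vanishes on `P + V`
  have hzero : ∀ v ∈ V, eval (v + P) A.det = 0 := by
    intro v hv
    rw [hV, LinearMap.mem_ker, hΦ, Matrix.mulVecLin_apply] at hv
    have h1 : A.map (eval (v + P)) *ᵥ w = 0 := by
      rw [map_eval_mulVec_eq A (fun i j => hA i j) w (v + P), Matrix.mulVec_add, hv, zero_add,
        ← map_eval_mulVec_eq A (fun i j => hA i j) w P, hw]
    rw [RingHom.map_det, RingHom.mapMatrix_apply]
    exact Matrix.exists_mulVec_eq_zero_iff.mp ⟨w, hw0, h1⟩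
  -- Step 3: `per` has no zero on `P + V`, hence `transl P per` is constant on `V`
  have hne : ∀ v ∈ V, eval v (transl P (perPoly (Fin (k + 3)) ℂ)) ≠ 0 := by
    intro v hv h0
    have h := hzero v hv
    rw [hdet, map_add, map_mul, eval_C, ← eval_transl, h0, zero_mul, add_zero] at h
    exact hc h
  have hconst : ∀ v ∈ V, eval v (transl P (perPoly (Fin (k + 3)) ℂ)) =
      eval 0 (transl P (perPoly (Fin (k + 3)) ℂ)) := fun v hv =>
    eval_eq_eval_zero_of_forall_mem_ne_zero _ V hne hv
  -- Step 4: isotropy and the dimension bound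
  have hiso : ∀ u ∈ V, ∀ v ∈ V, Matrix.toBilin' H u v = 0 := fun u hu v hv =>
    hess0_isOrtho_of_forall_mem _ V hconst hu hv
  have h2V := two_mul_finrank_le_of_isOrtho H hHdet V hiso
  rw [Fintype.card_prod, Fintype.card_fin] at h2V
  nlinarith

/-- **Registered stub `stub_unitDichotomy`** (line `dim2_cases`, crux `TwoDimCoefficients`,
stmt-ValiantsHypothesis-8062): if an affine `m × m` determinant has no zero on the permanental
hypersurface (`n ≥ 3`), then it is constant or `n² ≤ 2m + 2` (indeed `n² ≤ 2m`).
[cite: MignonRessayre2004, Thm. 1.1] -/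
theorem stub_unitDichotomy : UnitDichotomy := by
  intro n hn m A hA hZ
  obtain ⟨k, rfl⟩ : ∃ k, n = k + 3 := ⟨n - 3, by omega⟩
  obtain ⟨c, q, hc, hdet⟩ := exists_eq_C_add_perPoly_mul (by omega) A.det hZ
  by_cases hq : q = 0
  · exact Or.inl ⟨c, by rw [hdet, hq, mul_zero, add_zero]⟩
  · have h := sq_le_two_mul_of_det_eq_C_add_perPoly_mul A hA hc hq hdet
    exact Or.inr (by omega)

end UnitCase

end Summit.ValiantsHypothesis.ValiantsHypothesis.Cruxes.TwoDimCoefficients.DimTwoCases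

end
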